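import Literature.NumberTheory.CubicFields.VoronoiRelativeMinima
import Literature.NumberTheory.CubicFields.ArtinUnitInequalityCore
import Mathlib.NumberTheory.NumberField.Units.Basic
import Mathlib.NumberTheory.NumberField.Discriminant.Defs
import Mathlib.FieldTheory.PrimitiveElement
import Mathlib.RingTheory.Discriminant
import HarnessLib

/-!
# Artin's inequality: `|d_K| ≤ 4ε³ + 24` for a unit `ε > 1` of a cubic field with one real place

Topic `Literature/NumberTheory/CubicFields`, namespace `Literature.NumberTheory.CubicFields` (next to
`VoronoiRelativeMinima.lean`, whose signature-(1,1) set-up — a real embedding `σ₁`, a non-real embedding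
`σ₂`, `[K:ℚ] = 3` — and lemmas `embedding_cases`, `norm_eq_mul_norm_sq` are reused).  Everything here is
PROVED (theorems only, standard axioms).

**Theorem** (`abs_discr_le_of_unit`, "Artin's inequality"; E. Artin, *Theory of Algebraic Numbers*,
Göttingen lectures 1956/59; D. A. Marcus, *Number Fields*, Ch. 5, Exercises 35–36; printed with proof as
Alaca–Williams, *Introductory Algebraic Number Theory* (2004), Theorem 13.6.1 [held: corpus
book:alaca2003 pp. 275–277, `|d(K)| < 4(η³ + η⁻³ + 6)`, hence `η³ > (|d(K)| − 27)/4`]).  Let `K` be a cubic number field with a real embedding `σ₁` and a non-real embedding `σ₂` (so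
`d_K < 0`), and let `u` be a unit of `𝓞 K` with `ε := σ₁ u > 1`.  Then `|d_K| ≤ 4ε³ + 24`.
(The printed statement is strict; we prove `≤`, which is what is used.)

Consequence (`regulator`-free form, `log_abs_discr_le_of_unit`): `log |d_K| ≤ 3 log ε + log 28`, i.e.
every unit `> 1` under the real embedding — in particular the fundamental unit, whose logarithm is the
regulator `R_K` — satisfies `log ε ≥ (log|d_K| − log 28)/3`: an EXPLICIT lower bound for the regulator of
every complex cubic field (e.g. every pure cubic field `ℚ(∛m)`), to be combined with the effective upper
bound `h_K R_K ≤ 7√|d_K| log²|d_K|` (cell B2b-1, `…ResidueUpper.lean`).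

Proof.  `u ∉ ℚ` (else `ε³ = N(u) = ±1`), so `ℚ(u) = K` (degree `3` is prime) and the three embeddings
`σ₁, σ₂, σ̄₂` take distinct values `ε, z, z̄` at `u`, with `ε|z|² = |N u| = 1`.  The discriminant of the
`ℚ`-basis `(1, u, u²)` is the Vandermonde square `((z−ε)(z̄−ε)(z̄−z))²`, of absolute value
`((ε − Re z)² + (Im z)²)² · 4(Im z)²`, which the elementary inequality `artin_core` (polynomial heart
`(1 − c²)(x² − 2xc + 1)² ≤ x⁴ + 6x²` for `x ≥ 1`, `|c| ≤ 1`, via `ξ = x + 1/x`) bounds by `4ε³ + 24`; and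
`disc(1,u,u²) = [𝓞_K : ℤ[u]]² · d_K` (integral change of basis from an integral basis), so
`|d_K| ≤ |disc(1,u,u²)|`.

## References
* Ş. Alaca, K. S. Williams, *Introductory Algebraic Number Theory*, Cambridge Univ. Press (2004),
  Theorem 13.6.1 and its proof, pp. 275–277. [AlacaWilliams2003]
* D. A. Marcus, *Number Fields*, Springer Universitext (1977), Ch. 5, Exercises 35–36. [Marcus1977]
* H. Cohen, *A Course in Computational Algebraic Number Theory*, GTM 138 (1993), §6.4. [Cohen1993]
* E. Artin, *Theory of Algebraic Numbers*, Göttingen (1959), §12 (the original inequality).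
-/

noncomputable section

open scoped NumberField ComplexConjugate
open NumberField Module

namespace Literature.NumberTheory.CubicFields

/-! ### The number-field statement -/

section Unit

variable {K : Type*} [Field K] [NumberField K] (σ₁ : K →+* ℝ) (σ₂ : K →+* ℂ)
variable (hdeg : finrank ℚ K = 3) (hσ₂ : ∃ z : K, starRingEnd ℂ (σ₂ z) ≠ σ₂ z)

include hdeg hσ₂ in
/-- For a unit `u` with `σ₁ u = ε > 1`: `ε · ‖σ₂ u‖² = 1` (`|N u| = 1` and `N u = σ₁ u · ‖σ₂ u‖²`). [folklore] -/
theorem unit_mul_norm_sq_eq_one (u : (𝓞 K)ˣ) (hε : 1 < σ₁ ((u : 𝓞 K) : K)) :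
    σ₁ ((u : 𝓞 K) : K) * ‖σ₂ ((u : 𝓞 K) : K)‖ ^ 2 = 1 := by
  have h1 : |(RingOfIntegers.norm ℚ (u : 𝓞 K) : ℚ)| = 1 := NumberField.isUnit_iff_norm.mp u.isUnit
  have h2 : ((Algebra.norm ℚ ((u : 𝓞 K) : K) : ℚ) : ℝ) = σ₁ ((u : 𝓞 K) : K) * ‖σ₂ ((u : 𝓞 K) : K)‖ ^ 2 :=
    norm_eq_mul_norm_sq σ₁ σ₂ hdeg hσ₂ _
  rw [RingOfIntegers.coe_norm] at h1
  have h3 : |σ₁ ((u : 𝓞 K) : K) * ‖σ₂ ((u : 𝓞 K) : K)‖ ^ 2| = 1 := by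
    rw [← h2, ← Rat.cast_abs, h1]; simp
  have h4 : 0 ≤ σ₁ ((u : 𝓞 K) : K) * ‖σ₂ ((u : 𝓞 K) : K)‖ ^ 2 := by positivity
  rw [abs_of_nonneg h4] at h3
  exact h3

include hdeg hσ₂ in
/-- A unit `u` with `σ₁ u > 1` is irrational: `u ∉ ℚ` (else `N u = u³ = 1` with `u > 1`). [folklore] -/
theorem unit_not_mem_range (u : (𝓞 K)ˣ) (hε : 1 < σ₁ ((u : 𝓞 K) : K)) :
    ((u : 𝓞 K) : K) ∉ Set.range (algebraMap ℚ K) := by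
  rintro ⟨q, hq⟩
  have h := unit_mul_norm_sq_eq_one σ₁ σ₂ hdeg hσ₂ u hε
  rw [← hq] at h hε
  have h1 : σ₁ (algebraMap ℚ K q) = (q : ℝ) := by simp
  have h2 : σ₂ (algebraMap ℚ K q) = (q : ℂ) := by simp
  rw [h1] at h hε
  rw [h2] at h
  have h3 : ‖(q : ℂ)‖ = |(q : ℝ)| := by
    rw [show (q : ℂ) = ((q : ℝ) : ℂ) by norm_cast, Complex.norm_real, Real.norm_eq_abs]
  rw [h3, sq_abs] at h
  nlinarith

include hdeg hσ₂ in
/-- Hence `ℚ(u) = K` (`[K:ℚ] = 3` is prime). [folklore] -/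
theorem adjoin_unit_eq_top (u : (𝓞 K)ˣ) (hε : 1 < σ₁ ((u : 𝓞 K) : K)) :
    IntermediateField.adjoin ℚ {((u : 𝓞 K) : K)} = ⊤ := by
  set v : K := ((u : 𝓞 K) : K) with hv
  have hnot : v ∉ (⊥ : IntermediateField ℚ K) := by
    rw [IntermediateField.mem_bot]; exact unit_not_mem_range σ₁ σ₂ hdeg hσ₂ u hε
  have h1 : finrank ℚ (IntermediateField.adjoin ℚ {v}) ≠ 1 := by
    rw [Ne, IntermediateField.finrank_adjoin_simple_eq_one_iff]; exact hnot
  have hdvd : finrank ℚ (IntermediateField.adjoin ℚ {v}) ∣ 3 := by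
    rw [← hdeg]
    exact Dvd.intro _ (Module.finrank_mul_finrank ℚ (IntermediateField.adjoin ℚ {v}) K)
  have h3 : finrank ℚ (IntermediateField.adjoin ℚ {v}) = 3 := by
    rcases (Nat.dvd_prime Nat.prime_three).mp hdvd with h | h
    · exact absurd h h1
    · exact h
  exact IntermediateField.eq_of_le_of_finrank_eq le_top
    (by rw [h3, IntermediateField.finrank_top', hdeg])

include hdeg hσ₂ in
/-- Two `ℚ`-algebra embeddings `K → ℂ` that agree at the unit `u` are equal. [folklore] -/
theorem algHom_eq_of_apply_unit_eq (u : (𝓞 K)ˣ) (hε : 1 < σ₁ ((u : 𝓞 K) : K))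
    {φ ψ : K →ₐ[ℚ] ℂ} (h : φ ((u : 𝓞 K) : K) = ψ ((u : 𝓞 K) : K)) : φ = ψ := by
  set v : K := ((u : 𝓞 K) : K) with hv
  have htop : Algebra.adjoin ℚ {v} = ⊤ := by
    rw [← IntermediateField.adjoin_simple_toSubalgebra_of_isAlgebraic (Algebra.IsAlgebraic.isAlgebraic v),
      adjoin_unit_eq_top σ₁ σ₂ hdeg hσ₂ u hε, IntermediateField.top_toSubalgebra]
  exact AlgHom.ext_of_adjoin_eq_top htop (fun x hx => by rw [Set.mem_singleton_iff.mp hx]; exact h)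

include hdeg hσ₂ in
/-- **The discriminant of `(1, u, u²)` as a Vandermonde square**: with `ε = σ₁ u`, `z = σ₂ u`,
`disc_ℚ(1, u, u²) = ((z − ε)(z̄ − ε)(z̄ − z))²` in `ℂ`. [folklore] -/
theorem discr_powers_eq (u : (𝓞 K)ˣ) :
    algebraMap ℚ ℂ (Algebra.discr ℚ ![(1 : K), ((u : 𝓞 K) : K), ((u : 𝓞 K) : K) ^ 2]) =
      ((σ₂ ((u : 𝓞 K) : K) - (σ₁ ((u : 𝓞 K) : K) : ℂ)) *
        (starRingEnd ℂ (σ₂ ((u : 𝓞 K) : K)) - (σ₁ ((u : 𝓞 K) : K) : ℂ)) *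
        (starRingEnd ℂ (σ₂ ((u : 𝓞 K) : K)) - σ₂ ((u : 𝓞 K) : K))) ^ 2 := by
  classical
  set v : K := ((u : 𝓞 K) : K) with hv
  -- the three embeddings, as `ℚ`-algebra maps
  have hne := conjugate_ne_self σ₂ hσ₂
  have h1 : (algebraMap ℝ ℂ).comp σ₁ ≠ σ₂ := by
    intro h; apply hne; rw [← h]; exact conjugate_ofReal_comp σ₁
  have h2 : (algebraMap ℝ ℂ).comp σ₁ ≠ ComplexEmbedding.conjugate σ₂ := by
    intro h; apply h1
    have h' := congrArg ComplexEmbedding.conjugate h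
    have hinv : ComplexEmbedding.conjugate (ComplexEmbedding.conjugate σ₂) = σ₂ := star_star σ₂
    rw [conjugate_ofReal_comp σ₁, hinv] at h'
    exact h'
  let φ : Fin 3 → (K →+* ℂ) := ![(algebraMap ℝ ℂ).comp σ₁, σ₂, ComplexEmbedding.conjugate σ₂]
  let f : Fin 3 → (K →ₐ[ℚ] ℂ) := fun i => (φ i).toRatAlgHom
  have hf_inj : Function.Injective f := by
    intro i j hij
    have hij' : φ i = φ j := by
      have := congrArg (fun g : K →ₐ[ℚ] ℂ => (g : K →+* ℂ)) hij
      simpa [f] using this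
    fin_cases i <;> fin_cases j
    · rfl
    · exact absurd hij' h1
    · exact absurd hij' h2
    · exact absurd hij'.symm h1
    · rfl
    · exact absurd hij' hne.symm
    · exact absurd hij'.symm h2
    · exact absurd hij'.symm hne.symm
    · rfl
  have hf_bij : Function.Bijective f := by
    rw [Fintype.bijective_iff_injective_and_card]
    exact ⟨hf_inj, by rw [AlgHom.card, hdeg, Fintype.card_fin]⟩
  let e : Fin 3 ≃ (K →ₐ[ℚ] ℂ) := Equiv.ofBijective f hf_bij
  set b : Fin 3 → K := ![(1 : K), v, v ^ 2] with hb
  have hdisc := Algebra.discr_eq_det_embeddingsMatrixReindex_pow_two ℚ ℂ b e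
  rw [hdisc]
  -- the `3 × 3` Vandermonde determinant
  have hM : ∀ i j, Algebra.embeddingsMatrixReindex ℚ ℂ b e i j = φ j (b i) := by
    intro i j
    simp [Algebra.embeddingsMatrixReindex, Algebra.embeddingsMatrix, e, f]
  have hφ0 : φ 0 v = (σ₁ v : ℂ) := by simp [φ]
  have hφ1 : φ 1 v = σ₂ v := by simp [φ]
  have hφ2 : φ 2 v = starRingEnd ℂ (σ₂ v) := by simp [φ, ComplexEmbedding.conjugate_coe_eq]
  rw [Matrix.det_fin_three]
  simp only [hM]
  have hb0 : b 0 = 1 := by simp [hb]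
  have hb1 : b 1 = v := by simp [hb]
  have hb2 : b 2 = v ^ 2 := by simp [hb]
  simp only [hb0, hb1, hb2, map_one, map_pow, hφ0, hφ1, hφ2]
  ring

omit [NumberField K] in
/-- **Integral change of basis**: for `w : Fin 3 → 𝓞 K` (any number field `K` of degree `3`),
`disc_ℚ(w) = m² · d_K` for an integer `m` (the determinant of the coordinates of `w` in an integral
basis); hence `|d_K| ≤ |disc_ℚ(w)|` as soon as `disc_ℚ(w) ≠ 0`. [folklore] -/
theorem abs_discr_le_abs_discr_of_ne_zero [NumberField K] (hdeg : finrank ℚ K = 3) (w : Fin 3 → 𝓞 K)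
    (hne : Algebra.discr ℚ (fun i => ((w i : 𝓞 K) : K)) ≠ 0) :
    (|discr K| : ℚ) ≤ |Algebra.discr ℚ (fun i => ((w i : 𝓞 K) : K))| := by
  classical
  set ι := Free.ChooseBasisIndex ℤ (𝓞 K)
  have hcard : Fintype.card ι = 3 := by
    rw [← hdeg, Module.finrank_eq_card_basis (integralBasis K)]
  let e0 : ι ≃ Fin 3 := Fintype.equivFinOfCardEq hcard
  let B0 : Basis (Fin 3) ℚ K := (integralBasis K).reindex e0
  set b : Fin 3 → K := fun i => ((w i : 𝓞 K) : K) with hb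
  -- integer coordinates of `b i` in the integral basis
  let P' : Matrix (Fin 3) (Fin 3) ℤ := Matrix.of fun i j => (RingOfIntegers.basis K).repr (w i) (e0.symm j)
  let P : Matrix (Fin 3) (Fin 3) ℚ := P'.map (Int.castRingHom ℚ)
  have hP : ∀ i j, P i j = B0.repr (b i) j := by
    intro i j
    simp only [P, P', B0, Matrix.map_apply, Matrix.of_apply, Basis.repr_reindex_apply, hb]
    rw [show ((w i : 𝓞 K) : K) = algebraMap (𝓞 K) K (w i) from rfl, integralBasis_repr_apply]
    rfl
  have hPb : Matrix.mulVec (P.map (algebraMap ℚ K)) (⇑B0) = b := by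
    funext i
    simp only [Matrix.mulVec, dotProduct, Matrix.map_apply, hP, ← Algebra.smul_def]
    exact B0.sum_repr (b i)
  have hdisc : Algebra.discr ℚ b = P.det ^ 2 * Algebra.discr ℚ (⇑B0) := by
    rw [← hPb]; exact Algebra.discr_of_matrix_mulVec (⇑B0) P
  have hB0 : Algebra.discr ℚ (⇑B0) = (discr K : ℚ) := by
    rw [coe_discr]
    simp only [B0, Basis.coe_reindex]
    exact Algebra.discr_reindex ℚ (integralBasis K) e0
  have hdet : P.det = (P'.det : ℚ) := by
    simp only [P]
    rw [← RingHom.mapMatrix_apply, ← RingHom.map_det]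
    rfl
  rw [hB0, hdet] at hdisc
  -- `m = det P' ≠ 0`, so `m² ≥ 1`
  have hm : P'.det ≠ 0 := by
    intro h0
    apply hne
    rw [hdisc, h0]
    simp
  have hm1 : (1 : ℚ) ≤ (P'.det : ℚ) ^ 2 := by
    have h1 : 1 ≤ |P'.det| := Int.one_le_abs hm
    have h2 : (1 : ℚ) ≤ |(P'.det : ℚ)| := by exact_mod_cast h1
    nlinarith [abs_nonneg (P'.det : ℚ), sq_abs (P'.det : ℚ)]
  rw [hdisc, abs_mul, abs_of_nonneg (sq_nonneg (P'.det : ℚ))]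
  have h0 : 0 ≤ |(discr K : ℚ)| := abs_nonneg _
  nlinarith

include hdeg hσ₂ in
/-- **Artin's inequality**: for a cubic field `K` with a real embedding `σ₁` and a non-real embedding
`σ₂`, and a unit `u` of `𝓞 K` with `ε = σ₁ u > 1`: `|d_K| ≤ 4ε³ + 24`. [cite: AlacaWilliams2003, Thm 13.6.1] -/
theorem abs_discr_le_of_unit (u : (𝓞 K)ˣ) (hε : 1 < σ₁ ((u : 𝓞 K) : K)) :
    (|discr K| : ℝ) ≤ 4 * σ₁ ((u : 𝓞 K) : K) ^ 3 + 24 := by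
  classical
  set v : K := ((u : 𝓞 K) : K) with hv
  set ε : ℝ := σ₁ v with hεdef
  set z : ℂ := σ₂ v with hz
  -- archimedean data
  have hnorm : ε * (z.re ^ 2 + z.im ^ 2) = 1 := by
    have h := unit_mul_norm_sq_eq_one σ₁ σ₂ hdeg hσ₂ u hε
    rw [← hv, ← hεdef, ← hz, Complex.sq_norm, Complex.normSq_apply] at h
    nlinarith [h]
  have hcore := Artin.artin_core hε.le hnorm
  -- the discriminant of `(1, u, u²)`
  set w : Fin 3 → 𝓞 K := ![1, (u : 𝓞 K), (u : 𝓞 K) ^ 2] with hw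
  have hwb : (fun i => ((w i : 𝓞 K) : K)) = ![(1 : K), v, v ^ 2] := by
    funext i
    fin_cases i <;> simp [hw, hv]
  set D : ℂ := (z - (ε : ℂ)) * (starRingEnd ℂ z - (ε : ℂ)) * (starRingEnd ℂ z - z) with hD
  have hdiscC : algebraMap ℚ ℂ (Algebra.discr ℚ (fun i => ((w i : 𝓞 K) : K))) = D ^ 2 := by
    rw [hwb]; exact discr_powers_eq σ₁ σ₂ hdeg hσ₂ u
  -- `‖D‖² = ((ε − Re z)² + (Im z)²)² · 4 (Im z)²`
  have hDnorm : ‖D‖ ^ 2 = ((ε - z.re) ^ 2 + z.im ^ 2) ^ 2 * (4 * z.im ^ 2) := by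
    rw [hD, norm_mul, norm_mul, mul_pow, mul_pow, Complex.sq_norm, Complex.sq_norm, Complex.sq_norm,
      Complex.normSq_apply, Complex.normSq_apply, Complex.normSq_apply]
    simp only [Complex.sub_re, Complex.sub_im, Complex.ofReal_re, Complex.ofReal_im, Complex.conj_re,
      Complex.conj_im]
    ring
  -- `D ≠ 0`: the three conjugates of `u` are distinct
  have hD0 : D ≠ 0 := by
    have hcne := conjugate_ne_self σ₂ hσ₂
    have h1 : (algebraMap ℝ ℂ).comp σ₁ ≠ σ₂ := by
      intro h; apply hcne; rw [← h]; exact conjugate_ofReal_comp σ₁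
    have h2 : (algebraMap ℝ ℂ).comp σ₁ ≠ ComplexEmbedding.conjugate σ₂ := by
      intro h; apply h1
      have h' := congrArg ComplexEmbedding.conjugate h
      have hinv : ComplexEmbedding.conjugate (ComplexEmbedding.conjugate σ₂) = σ₂ := star_star σ₂
      rw [conjugate_ofReal_comp σ₁, hinv] at h'
      exact h'
    -- values at `v`
    have hval : ∀ φ ψ : K →+* ℂ, φ v = ψ v → φ = ψ := by
      intro φ ψ h
      have h1 := algHom_eq_of_apply_unit_eq σ₁ σ₂ hdeg hσ₂ u hε (φ := φ.toRatAlgHom) (ψ := ψ.toRatAlgHom)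
        (by simpa using h)
      have h2 := congrArg (fun g : K →ₐ[ℚ] ℂ => (g : K →+* ℂ)) h1
      simpa using h2
    rw [hD]
    refine mul_ne_zero (mul_ne_zero ?_ ?_) ?_
    · intro h0
      apply h1.symm
      apply hval
      rw [hz] at h0
      have : σ₂ v = (ε : ℂ) := by linear_combination h0
      simpa [hεdef] using this
    · intro h0
      apply h2.symm
      apply hval
      have : starRingEnd ℂ z = (ε : ℂ) := by linear_combination h0
      simpa [hεdef, hz, ComplexEmbedding.conjugate_coe_eq] using this
    · intro h0
      apply hcne
      apply hval
      have : starRingEnd ℂ z = z := by linear_combination h0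
      simpa [hz, ComplexEmbedding.conjugate_coe_eq] using this
  have hdisc_ne : Algebra.discr ℚ (fun i => ((w i : 𝓞 K) : K)) ≠ 0 := by
    intro h0
    rw [h0, map_zero] at hdiscC
    exact pow_ne_zero 2 hD0 hdiscC.symm
  -- `|d_K| ≤ |disc_ℚ(1,u,u²)| = ‖D‖² ≤ 4ε³ + 24`
  have hle := abs_discr_le_abs_discr_of_ne_zero hdeg w hdisc_ne
  have habsC : (|Algebra.discr ℚ (fun i => ((w i : 𝓞 K) : K))| : ℝ) = ‖D‖ ^ 2 := by
    have h := congrArg (fun t : ℂ => ‖t‖) hdiscC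
    simp only [norm_pow] at h
    rw [← h]
    rw [show algebraMap ℚ ℂ (Algebra.discr ℚ (fun i => ((w i : 𝓞 K) : K))) =
      (((Algebra.discr ℚ (fun i => ((w i : 𝓞 K) : K)) : ℚ) : ℝ) : ℂ) by simp, Complex.norm_real,
      Real.norm_eq_abs]
  have hle' : (|discr K| : ℝ) ≤ (|Algebra.discr ℚ (fun i => ((w i : 𝓞 K) : K))| : ℝ) := by
    have := hle
    exact_mod_cast this
  calc (|discr K| : ℝ) ≤ (|Algebra.discr ℚ (fun i => ((w i : 𝓞 K) : K))| : ℝ) := hle'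
    _ = ‖D‖ ^ 2 := habsC
    _ = ((ε - z.re) ^ 2 + z.im ^ 2) ^ 2 * (4 * z.im ^ 2) := hDnorm
    _ ≤ 4 * ε ^ 3 + 24 := hcore

include hdeg hσ₂ in
/-- **Logarithmic form**: `log|d_K| ≤ 3 log(σ₁ u) + log 28` for every unit `u` with `σ₁ u > 1`
(`4ε³ + 24 ≤ 28ε³`).  In particular `log ε ≥ (log|d_K| − log 28)/3` for the fundamental unit, an explicit
lower bound for the regulator of every cubic field with one real place. [cite: AlacaWilliams2003, Thm 13.6.1] -/
theorem log_abs_discr_le_of_unit (u : (𝓞 K)ˣ) (hε : 1 < σ₁ ((u : 𝓞 K) : K)) :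
    Real.log |(discr K : ℝ)| ≤ 3 * Real.log (σ₁ ((u : 𝓞 K) : K)) + Real.log 28 := by
  have h := abs_discr_le_of_unit σ₁ σ₂ hdeg hσ₂ u hε
  set ε : ℝ := σ₁ ((u : 𝓞 K) : K) with hεdef
  have hε0 : 0 < ε := by linarith
  have hd0 : 0 < |(discr K : ℝ)| := abs_pos.mpr (Int.cast_ne_zero.mpr (discr_ne_zero K))
  have h28 : 4 * ε ^ 3 + 24 ≤ 28 * ε ^ 3 := by nlinarith [one_le_pow₀ (M₀ := ℝ) hε.le (n := 3)]
  calc Real.log |(discr K : ℝ)| ≤ Real.log (28 * ε ^ 3) := Real.log_le_log hd0 (h.trans h28)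
    _ = 3 * Real.log ε + Real.log 28 := by
        rw [Real.log_mul (by norm_num) (by positivity), Real.log_pow]; push_cast; ring

end Unit

end Literature.NumberTheory.CubicFields

end
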